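import Literature.AnabelianGeometry.EtaleTheta.Discharge.Sec5Thm57EtaleTorsionOfRigidityTower

/-!
# [EtTh] §5, Theorem 5.7 (C)-chain, ÉTALE half: the torsion clause «`κ_N^{2l}` is a coboundary» from the WEAKER cross-level
# separation binder `hsep^{(2l)}` (exponent `2·l` instead of `2`)

Mochizuki, *The étale theta function and its Frobenioid-theoretic manifestations*, Publ. RIMS **45** (2009) [EtTh] (refereed)
[cite: MochizukiEtTh2009, Cor 2.19 (iii) p.291 (PDF p.65); Cor 2.8 (i) p.268 (PDF p.42); Prop 1.4 (ii) p.248 (PDF p.22);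
Thm 5.7 proof p.330 (PDF p.104)].  Layer L2 of the abc-iut cell, seat abc-iut-f-123 (gen 8), abc-iut-L2-lead row R983
«HSEP@TATE-DATUM».  PROOF-ONLY twin (0 definitions) of abc-iut-w6-d049's `ThetaEnvTower.etaleTorsion_of_cor219iiiStd`
(`Discharge/Sec5Thm57EtaleTorsionOfRigidityTower`, p478416), whose helper lemmas are consumed BY NAME; nothing landed is edited.

WHY.  This seat's `Discharge/Sec5Thm57HsepTorsionObstruction` (p497402) shows that the binder `hsep` of the original theorem —
«two compatible families of theta cocycles with `aug`-inflated ratio differ, at every level, by a function whose SQUARE is a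
coboundary» — is UNINHABITABLE whenever `Π^tp_X` acts trivially on `Δ_Θ/l·Δ_Θ` (print: `μ_l ⊆ K`; at the model of record:
`l ∣ p − 1`, `Sec5Thm57HsepRefutedAtModelTate`): the collections of theta cocycles absorb the `μ_l`-ambiguity of the
`l·Δ_Θ`-lifts (Cor. 2.8 (i)), whose class is `l`-torsion, not `2`-torsion.  The original proof, however, uses the `hsep`-witness
`d₁` only through `d₁^l` (`factor_pow_two_mul_eq_coboundary`).  This file records the theorem with the binder WEAKENED to
exponent `2·l`:

  `hsep^{(2l)}`: «… differ, at every level `M`, by a function whose `(2l)`-th POWER is a `μ_M`-coboundary»,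

which is NOT hit by the `μ_l`-witness (`redConj_pow_eq`: its `l`-th power is already a coboundary), with the SAME conclusion
(E-tors_M) «`κ_M^{2l}` is a coboundary» at every level (witness `d := (γ_μ(d₁·d₂²))⁻¹`).  Here `l` is the exponent of the
theorem itself (the `l` of `hstd`'s standard-type clause `c_M^l ∼ ∂` and of the conclusion); consumers instantiate it with the
`l` of `X̲̲` (`DoubleUnderline l`), for which the obstruction of p497402 is exactly `l`-torsion.
RESULT: `ThetaEnvTower.etaleTorsion_of_cor219iiiStd_of_hsepPow` (+ the bookkeeping variant
`factor_pow_two_mul_eq_coboundary_of_pow`).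

HONEST FRAMING: kernel-checked implications between typed statements over an ABSTRACT tower; none of `hstd`/`hinf`/`hsep^{(2l)}`/
`hηc`/`hC5` is proved here, nor asserted to hold at any model; nothing of [EtTh] is asserted unconditionally; typed ≠ discharged;
no side taken on anything downstream ([IUTchIII] Cor. 3.12 in particular).
-/

namespace Literature.AnabelianGeometry.EtaleTheta

universe u

namespace ThetaEnvTower

variable {E : Set ℕ+} (𝒯 : ThetaEnvTower.{u} E)

/-- **Assembling the torsion of the pull-back factor, exponent-`2l` input**: if `γ^*η = η₁·e` with `(η₁·η⁻¹)^{2l}` and `e^l`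
coboundaries, then the factor `f := η₁·e·η⁻¹` has `f^{2l}` a coboundary (of `d₁·d₂²`).
[cite: MochizukiEtTh2009, Cor 2.8 (i) p.268 (PDF p.42); Prop 1.4 (ii) p.248 (PDF p.22)] -/
theorem factor_pow_two_mul_eq_coboundary_of_pow (M : E) (η η₁ e : 𝒯.PiYdd → 𝒯.mu M) {l : ℕ} {d₁ d₂ : 𝒯.mu M}
    (h₁ : ∀ k, (η₁ k * (η k)⁻¹) ^ (2 * l) = CycEnvelope.coboundary (𝒯.aug.comp 𝒯.PiYdd.subtype) (𝒯.chi M) d₁ k)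
    (h₂ : ∀ k, e k ^ l = CycEnvelope.coboundary (𝒯.aug.comp 𝒯.PiYdd.subtype) (𝒯.chi M) d₂ k) (k : 𝒯.PiYdd) :
    (η₁ k * e k * (η k)⁻¹) ^ (2 * l) =
      CycEnvelope.coboundary (𝒯.aug.comp 𝒯.PiYdd.subtype) (𝒯.chi M) (d₁ * d₂ ^ 2) k := by
  have hre : η₁ k * e k * (η k)⁻¹ = (η₁ k * (η k)⁻¹) * e k := mul_right_comm _ _ _
  rw [hre, mul_pow, h₁, mul_comm 2 l, pow_mul, h₂, CycEnvelope.coboundary_pow_apply, CycEnvelope.coboundary_mul_apply]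

/-- **(E-tors) at every level from constant-multiple rigidity on the tower, translation-freeness and the WEAKENED separation
across levels `hsep^{(2l)}`.**  Verbatim the binders of abc-iut-w6-d049's `etaleTorsion_of_cor219iiiStd` — `hstd` (the conclusion
shape of `MuTwoSetting.Cor219_iii_std`, F-0652), the glue `hγμχ`/`hγμred`/`haug`, a COMPATIBLE family `η` of members with `hC5`,
the inflatedness `hinf` of `κ` — EXCEPT that the cross-level separation binder now only asks for the `(2l)`-th power of the ratio
to be a coboundary (the exponent-`2` form is refuted under `μ_l ⊆ K` by p497402).  Conclusion unchanged: at every level `M`,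
`κ_M^{2l}` is a coboundary — the input `htors` of `ThetaFrobenioid.kummerTorsion_of_etaleTorsion` (p473372) with `n := 2l`.
[cite: MochizukiEtTh2009, Cor 2.19 (iii) p.291 (PDF p.65); Cor 2.8 (i) p.268 (PDF p.42); Prop 1.4 (ii) p.248 (PDF p.22); Thm 5.7 proof p.330 (PDF p.104)] -/
theorem etaleTorsion_of_cor219iiiStd_of_hsepPow {l : ℕ} (γ : 𝒯.PiX ≃ₜ* 𝒯.PiX)
    (hγ : 𝒯.PiYdd.map γ.toMulEquiv.toMonoidHom = 𝒯.PiYdd) (hγ' : ∀ x : 𝒯.PiX, x ∈ 𝒯.PiYdd → γ x ∈ 𝒯.PiYdd)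
    (γμ : ∀ M : E, 𝒯.mu M ≃* 𝒯.mu M)
    (hstd : ∃ c : ∀ M : E, 𝒯.G → 𝒯.mu M,
      (∀ M, CycEnvelope.IsEnvCocycle (MonoidHom.id 𝒯.G) (𝒯.chi M) (c M)) ∧
      (∀ M, IsLocallyConstant (c M ∘ 𝒯.aug)) ∧
      (∀ (M M' : E) (h : (M : ℕ+) ∣ M'), 𝒯.red M M' h ∘ c M' = c M) ∧
      (∀ M, 𝒯.pullbackCocycle M γ hγ (γμ M) '' 𝒯.thetaCocycles M =
        (fun η => η * (c M ∘ 𝒯.aug ∘ 𝒯.PiYdd.subtype)) '' 𝒯.thetaCocycles M) ∧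
      ∀ M : E, ∃ d : 𝒯.mu M, ∀ g : 𝒯.G, c M g ^ l = CycEnvelope.coboundary (MonoidHom.id 𝒯.G) (𝒯.chi M) d g)
    (hγμχ : ∀ (M : E) (x : 𝒯.PiX) (t : 𝒯.mu M), γμ M (𝒯.chi M (𝒯.aug x) t) = 𝒯.chi M (𝒯.aug (γ x)) (γμ M t))
    (hγμred : ∀ (M M' : E) (h : (M : ℕ+) ∣ M') (t : 𝒯.mu M'), 𝒯.red M M' h (γμ M' t) = γμ M (𝒯.red M M' h t))
    (haug : ∀ x y : 𝒯.PiX, 𝒯.aug x = 𝒯.aug y → 𝒯.aug (γ x) = 𝒯.aug (γ y))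
    (η : ∀ M : E, 𝒯.PiYdd → 𝒯.mu M) (hη : ∀ M, η M ∈ 𝒯.thetaCocycles M)
    (hηc : ∀ (M M' : E) (h : (M : ℕ+) ∣ M'), 𝒯.red M M' h ∘ η M' = η M)
    (κ : ∀ M : E, 𝒯.PiYdd → 𝒯.mu M)
    (hC5 : ∀ (M : E) (k : 𝒯.PiYdd), γμ M (η M k) = η M ⟨γ k, hγ' k k.2⟩ * κ M ⟨γ k, hγ' k k.2⟩)
    (hinf : ∀ (M : E) (k k' : 𝒯.PiYdd), 𝒯.aug k = 𝒯.aug k' → κ M k = κ M k')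
    (hsepPow : ∀ η' : ∀ M : E, 𝒯.PiYdd → 𝒯.mu M, (∀ M, η' M ∈ 𝒯.thetaCocycles M) →
      (∀ (M M' : E) (h : (M : ℕ+) ∣ M'), 𝒯.red M M' h ∘ η' M' = η' M) →
      (∀ (M : E) (k k' : 𝒯.PiYdd), 𝒯.aug k = 𝒯.aug k' → η' M k * (η M k)⁻¹ = η' M k' * (η M k')⁻¹) →
      ∀ M : E, ∃ d : 𝒯.mu M, ∀ k : 𝒯.PiYdd,
        (η' M k * (η M k)⁻¹) ^ (2 * l) = CycEnvelope.coboundary (𝒯.aug.comp 𝒯.PiYdd.subtype) (𝒯.chi M) d k)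
    (M : E) :
    ∃ d : 𝒯.mu M, ∀ k : 𝒯.PiYdd,
      κ M k ^ (2 * l) = CycEnvelope.coboundary (𝒯.aug.comp 𝒯.PiYdd.subtype) (𝒯.chi M) d k := by
  classical
  obtain ⟨c, -, -, hcred, hset, htor⟩ := hstd
  -- the member `η₁_M` with `γ^*η_M = η₁_M · (c_M ∘ aug)` at every level (chosen), and its formula
  have hex : ∀ M' : E, ∃ η₁ ∈ 𝒯.thetaCocycles M',
      η₁ * (c M' ∘ 𝒯.aug ∘ 𝒯.PiYdd.subtype) = 𝒯.pullbackCocycle M' γ hγ (γμ M') (η M') := fun M' => by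
    have hmem : 𝒯.pullbackCocycle M' γ hγ (γμ M') (η M') ∈
        (fun η => η * (c M' ∘ 𝒯.aug ∘ 𝒯.PiYdd.subtype)) '' 𝒯.thetaCocycles M' := by
      rw [← hset M']
      exact ⟨η M', hη M', rfl⟩
    obtain ⟨η₁, hη₁, he⟩ := hmem
    exact ⟨η₁, hη₁, he⟩
  choose η₁ hη₁ hη₁e using hex
  -- pointwise formula: `η₁_M k = η_M k · (γμ_M⁻¹(κ_M(γ k)))⁻¹ · (c_M (aug k))⁻¹`
  have hform : ∀ (M' : E) (k : 𝒯.PiYdd),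
      η₁ M' k = η M' k * (((γμ M').symm (κ M' ⟨γ k, hγ' k k.2⟩))⁻¹ * (c M' (𝒯.aug k))⁻¹) := by
    intro M' k
    have hk := congrFun (hη₁e M') k
    simp only [Pi.mul_apply, Function.comp_apply, Subgroup.coe_subtype] at hk
    rw [pullbackCocycle_apply] at hk
    have hpb : (γμ M').symm (η M' ⟨γ k, 𝒯.apply_mem_PiYdd_of_map_eq γ hγ k k.2⟩) =
        η M' k * ((γμ M').symm (κ M' ⟨γ k, hγ' k k.2⟩))⁻¹ := by
      apply (γμ M').injective
      rw [MulEquiv.apply_symm_apply, map_mul, map_inv, MulEquiv.apply_symm_apply, hC5 M' k, mul_inv_cancel_right]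
    rw [hpb] at hk
    rw [← mul_assoc, ← hk, mul_inv_cancel_right]
  -- the chosen family is COMPATIBLE
  have hη₁c : ∀ (M M' : E) (h : (M : ℕ+) ∣ M'), 𝒯.red M M' h ∘ η₁ M' = η₁ M := by
    intro M M' h
    funext k
    have hk' := congrFun (hη₁e M') k
    have hk := congrFun (hη₁e M) k
    simp only [Pi.mul_apply, Function.comp_apply, Subgroup.coe_subtype] at hk hk'
    rw [pullbackCocycle_apply] at hk hk'
    -- reduce the level-`M'` identity
    have hred := congrArg (𝒯.red M M' h) hk'
    rw [map_mul, show 𝒯.red M M' h (c M' (𝒯.aug k)) = c M (𝒯.aug k) from congrFun (hcred M M' h) _,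
      show 𝒯.red M M' h ((γμ M').symm (η M' ⟨γ k, 𝒯.apply_mem_PiYdd_of_map_eq γ hγ k k.2⟩)) =
        (γμ M).symm (η M ⟨γ k, 𝒯.apply_mem_PiYdd_of_map_eq γ hγ k k.2⟩) from by
          apply (γμ M).injective
          rw [MulEquiv.apply_symm_apply, ← hγμred, MulEquiv.apply_symm_apply]
          exact congrFun (hηc M M' h) _, ← hk] at hred
    exact mul_right_cancel hred
  -- `η₁ / η` is inflated at every level (`κ` inflated, `γ` respects `aug`-fibres, `c` inflated)
  have hq : ∀ (M' : E) (k k' : 𝒯.PiYdd), 𝒯.aug k = 𝒯.aug k' →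
      η₁ M' k * (η M' k)⁻¹ = η₁ M' k' * (η M' k')⁻¹ := by
    intro M' k k' hkk
    rw [hform M' k, hform M' k', mul_inv_cancel_comm, mul_inv_cancel_comm,
      hinf M' ⟨γ k, hγ' k k.2⟩ ⟨γ k', hγ' k' k'.2⟩ (haug k k' hkk), hkk]
  -- weakened separation across levels: `(η₁/η)^{2l}` is a coboundary at level `M`
  obtain ⟨d₁, hd₁⟩ := hsepPow η₁ hη₁ hη₁c hq M
  obtain ⟨d₂, hd₂⟩ := htor M
  -- the pull-back factor `f := η₁ · (c ∘ aug) · η⁻¹` and its torsion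
  refine ⟨(γμ M (d₁ * d₂ ^ 2))⁻¹, fun k => ?_⟩
  refine 𝒯.pow_eq_coboundary_of_pullback M γ hγ hγ' (γμ M) (hγμχ M) (η M) (κ M) (hC5 M)
    (fun k => η₁ M k * c M (𝒯.aug k) * (η M k)⁻¹) (fun k => ?_) (fun k => ?_) k
  · -- `γ^*η = η · f`
    have hk := congrFun (hη₁e M) k
    simp only [Pi.mul_apply, Function.comp_apply, Subgroup.coe_subtype] at hk
    rw [← hk, mul_comm (η M k), mul_assoc, inv_mul_cancel, mul_one]
  · exact 𝒯.factor_pow_two_mul_eq_coboundary_of_pow M (η M) (η₁ M) (fun k => c M (𝒯.aug k)) hd₁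
      (fun k => hd₂ (𝒯.aug k)) k

/-- **The exponent-`2` binder implies the exponent-`2l` binder** (so the twin above is formally WEAKER in its hypotheses than
`etaleTorsion_of_cor219iiiStd`): raise the coboundary identity to the `l`-th power. [cite: MochizukiEtTh2009, Def 2.13 p.273 (PDF p.47)] -/
theorem hsepPow_of_hsep {l : ℕ} (η : ∀ M : E, 𝒯.PiYdd → 𝒯.mu M)
    (hsep : ∀ η' : ∀ M : E, 𝒯.PiYdd → 𝒯.mu M, (∀ M, η' M ∈ 𝒯.thetaCocycles M) →
      (∀ (M M' : E) (h : (M : ℕ+) ∣ M'), 𝒯.red M M' h ∘ η' M' = η' M) →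
      (∀ (M : E) (k k' : 𝒯.PiYdd), 𝒯.aug k = 𝒯.aug k' → η' M k * (η M k)⁻¹ = η' M k' * (η M k')⁻¹) →
      ∀ M : E, ∃ d : 𝒯.mu M, ∀ k : 𝒯.PiYdd,
        (η' M k * (η M k)⁻¹) ^ 2 = CycEnvelope.coboundary (𝒯.aug.comp 𝒯.PiYdd.subtype) (𝒯.chi M) d k) :
    ∀ η' : ∀ M : E, 𝒯.PiYdd → 𝒯.mu M, (∀ M, η' M ∈ 𝒯.thetaCocycles M) →
      (∀ (M M' : E) (h : (M : ℕ+) ∣ M'), 𝒯.red M M' h ∘ η' M' = η' M) →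
      (∀ (M : E) (k k' : 𝒯.PiYdd), 𝒯.aug k = 𝒯.aug k' → η' M k * (η M k)⁻¹ = η' M k' * (η M k')⁻¹) →
      ∀ M : E, ∃ d : 𝒯.mu M, ∀ k : 𝒯.PiYdd,
        (η' M k * (η M k)⁻¹) ^ (2 * l) = CycEnvelope.coboundary (𝒯.aug.comp 𝒯.PiYdd.subtype) (𝒯.chi M) d k := by
  intro η' hη' hη'c hinfl M
  obtain ⟨d, hd⟩ := hsep η' hη' hη'c hinfl M
  exact ⟨d ^ l, fun k => by rw [pow_mul, hd k, CycEnvelope.coboundary_pow_apply]⟩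

end ThetaEnvTower

end Literature.AnabelianGeometry.EtaleTheta
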